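import Mathlib

/-!
# Isolation normal form of clause (X) (crux `PrimeDensityDecay`, stmt-MatrixMultiplication-14311,
line `collision-profile-removal`, registered stub `stub_isolation`)

For a family of pairs `(A i, B i)_{i<n}` of finite subsets of an additive group, write
`X₀ := ⋃ⱼ (A j − B j)` for the set of PRIVATE (matched) differences.  Clause (X) of the simultaneous double
product property — `a ∈ A i`, `a' ∈ A j`, `b ∈ B j`, `b' ∈ B k`, `(a − a') + (b − b') = 0 ⇒ i = k` — is
EQUIVALENT to the isolation statement

  `A i` is disjoint from `B k + X₀` whenever `i ≠ k`

(`stub_isolation`), and dually to `Disjoint (B k) (A i − X₀)` for `i ≠ k` (`isolation_dual`).  In words: the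
window `B k + X₀` around the `B`-part of block `k` (a set of size `≥ |A k − B k|`, i.e. `≥ s²` under (W)) contains
no point of `X = ⋃ A i` except those of `A k` (and it does contain `A k` when `B k ≠ ∅`:
`A_subset_window`).  This is the normal form from which every attack on the open core starts (pivot packing,
translate-class packing, the common-grid / factorisation picture): each block reserves a large window that is
private with respect to `X`, and the whole difficulty of the crux is that the windows of different blocks may
overlap.
-/

namespace Summit.MatrixMultiplication.MatrixMultiplication.Theorems.PrimeDensityDecay.Isolation

open scoped BigOperators Pointwise

/-- **Isolation** (registered stub `stub_isolation`): clause (X) holds iff `A i ∩ (B k + X₀) = ∅` for all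
`i ≠ k`, where `X₀ = ⋃ⱼ (A j − B j)`. -/
theorem stub_isolation :
    ∀ {H : Type*} [AddCommGroup H] [DecidableEq H] {n : ℕ} (A B : Fin n → Finset H),
    (∀ i j k : Fin n, ∀ a ∈ A i, ∀ a' ∈ A j, ∀ b ∈ B j, ∀ b' ∈ B k, (a - a') + (b - b') = 0 → i = k) ↔
    ∀ i k : Fin n, i ≠ k → Disjoint (A i) (B k + Finset.univ.biUnion fun j => A j - B j) := by
  intro H _ _ n A B
  constructor
  · intro hX i k hik
    rw [Finset.disjoint_left]
    intro x hxA hxW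
    rw [Finset.mem_add] at hxW
    obtain ⟨b', hb', d, hd, rfl⟩ := hxW
    rw [Finset.mem_biUnion] at hd
    obtain ⟨j, -, hd⟩ := hd
    rw [Finset.mem_sub] at hd
    obtain ⟨a', ha', b, hb, rfl⟩ := hd
    exact hik (hX i j k (b' + (a' - b)) hxA a' ha' b hb b' hb' (by abel))
  · intro hD i j k a ha a' ha' b hb b' hb' h0
    by_contra hik
    have hmem : a ∈ B k + Finset.univ.biUnion fun j => A j - B j := by
      rw [Finset.mem_add]
      refine ⟨b', hb', a' - b, ?_, ?_⟩
      · rw [Finset.mem_biUnion]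
        exact ⟨j, Finset.mem_univ _, Finset.sub_mem_sub ha' hb⟩
      · have : a = b' + (a' - b) := by
          rw [← sub_eq_zero]
          rw [← h0]
          abel
        exact this.symm
    exact Finset.disjoint_left.mp (hD i k hik) ha hmem

/-- The dual isolation: clause (X) holds iff `B k ∩ (A i − X₀) = ∅` for all `i ≠ k`. -/
theorem isolation_dual {H : Type*} [AddCommGroup H] [DecidableEq H] {n : ℕ} (A B : Fin n → Finset H) :
    (∀ i j k : Fin n, ∀ a ∈ A i, ∀ a' ∈ A j, ∀ b ∈ B j, ∀ b' ∈ B k, (a - a') + (b - b') = 0 → i = k) ↔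
    ∀ i k : Fin n, i ≠ k → Disjoint (B k) (A i - Finset.univ.biUnion fun j => A j - B j) := by
  constructor
  · intro hX i k hik
    rw [Finset.disjoint_left]
    intro y hyB hyW
    rw [Finset.mem_sub] at hyW
    obtain ⟨a, ha, d, hd, rfl⟩ := hyW
    rw [Finset.mem_biUnion] at hd
    obtain ⟨j, -, hd⟩ := hd
    rw [Finset.mem_sub] at hd
    obtain ⟨a', ha', b, hb, rfl⟩ := hd
    exact hik (hX i j k a ha a' ha' b hb (a - (a' - b)) hyB (by abel))
  · intro hD i j k a ha a' ha' b hb b' hb' h0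
    by_contra hik
    have hmem : b' ∈ A i - Finset.univ.biUnion fun j => A j - B j := by
      rw [Finset.mem_sub]
      refine ⟨a, ha, a' - b, ?_, ?_⟩
      · rw [Finset.mem_biUnion]
        exact ⟨j, Finset.mem_univ _, Finset.sub_mem_sub ha' hb⟩
      · rw [← sub_eq_zero, ← h0]
        abel
    exact Finset.disjoint_left.mp (hD i k hik) hb' hmem

/-- Each window contains its own block's `A`-part: `A k ⊆ B k + X₀` as soon as `B k` is non-empty. -/
theorem A_subset_window {H : Type*} [AddCommGroup H] [DecidableEq H] {n : ℕ} (A B : Fin n → Finset H)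
    (k : Fin n) (hB : (B k).Nonempty) :
    A k ⊆ B k + Finset.univ.biUnion fun j => A j - B j := by
  intro a ha
  obtain ⟨b, hb⟩ := hB
  rw [Finset.mem_add]
  refine ⟨b, hb, a - b, ?_, by abel⟩
  rw [Finset.mem_biUnion]
  exact ⟨k, Finset.mem_univ _, Finset.sub_mem_sub ha hb⟩

/-- Under (X) (and `B k ≠ ∅`) the window of block `k` meets `X = ⋃ A i` exactly in `A k`. -/
theorem window_inter_X_eq {H : Type*} [AddCommGroup H] [DecidableEq H] {n : ℕ} (A B : Fin n → Finset H)
    (hX : ∀ i j k : Fin n, ∀ a ∈ A i, ∀ a' ∈ A j, ∀ b ∈ B j, ∀ b' ∈ B k, (a - a') + (b - b') = 0 → i = k)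
    (k : Fin n) (hB : (B k).Nonempty) :
    (B k + Finset.univ.biUnion fun j => A j - B j) ∩ (Finset.univ.biUnion A) = A k := by
  have hD := (stub_isolation A B).mp hX
  ext x
  simp only [Finset.mem_inter, Finset.mem_biUnion, Finset.mem_univ, true_and]
  constructor
  · rintro ⟨hxW, i, hxA⟩
    by_cases hik : i = k
    · exact hik ▸ hxA
    · exact (Finset.disjoint_left.mp (hD i k hik) hxA hxW).elim
  · intro hx
    exact ⟨A_subset_window A B k hB hx, k, hx⟩

end Summit.MatrixMultiplication.MatrixMultiplication.Theorems.PrimeDensityDecay.Isolation
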